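import Literature.Barriers.Schanuel.EFunctionValuesAtAlgebraicPointsForms
import Literature.Barriers.Schanuel.EFunctionValuesAtAlgebraicPointsMinors
import Mathlib.LinearAlgebra.Matrix.Nondegenerate
import Mathlib.LinearAlgebra.Matrix.Adjugate
import HarnessLib

/-!
# Barrier (Schanuel) `EFunctionValuesAtAlgebraicPoints`: the three matrix steps of Shidlovskii's lemma (Baker Ch. 11, Lemma 2) — proofs only

`Literature/Barriers/Schanuel/EFunctionValuesAtAlgebraicPointsSteps.lean` — sibling file of
`EFunctionValuesAtAlgebraicPoints.lean` in the programme to discharge `siegelShidlovskii_algIndep`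
(Siegel–Shidlovskii; Rivoal Thm. 5.10 = Baker Thm. 11.1). Three self-contained algebraic steps of
the proof of Shidlovskii's lemma (Baker, *Transcendental Number Theory*, Ch. 11, Lemma 2,
pp. 110–111), separated from the assembly so that each is a plain statement about matrices:

* `SiegelShidlovskii.kernel_matrix_step` — from "`MWQ = 0`" (`N Q = 0` with the rows of `N`
  independent over `R ⊇ K[X]`) and `R = Q_I` non-singular: `V = N_J` is non-singular and
  `det V · (S adj R)_{lj} = det R · (−adj(V) U)_{lj}` ("`SR⁻¹ = −V⁻¹U`", p. 111);
* `SiegelShidlovskii.common_denominator_step` — from entrywise bounded-height representations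
  `(S adj R)_{lj} q_{lj} = det R · p_{lj}` to a single identity `q · S = H R` with `q ≠ 0` and
  `deg q, deg H ≤ c + |entries|·c`;
* `SiegelShidlovskii.vecMul_adjugate_step` — the identity behind (4), p. 110: if `q S = H R` then
  for every row vector `y`, `det R · (q y_{I j₀} + ∑ₗ H_{l j₀} y_{J l}) = q · (y Q adj(R))_{j₀}`
  (i.e. `det R · (qA + BH) = q · L adj R` with `L = yQ = AR + BS`).

All [folklore]; no named facts.

## References

* A. Baker, *Transcendental Number Theory*, CUP 1975, Ch. 11 §2, proof of Lemma 2 (pp. 110–111).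
-/

noncomputable section

open Polynomial Matrix

namespace Literature.Barriers.Schanuel

namespace SiegelShidlovskii

variable {K : Type*} [Field K]
variable {n k : ℕ} {I : Fin k → Fin n} {J : Fin (n - k) → Fin n}

/-! ### 1. `SR⁻¹ = −V⁻¹U` -/

section KernelMatrix

variable {R : Type*} [CommRing R] [IsDomain R] [Algebra K R]

/-- **The kernel matrix step** (Baker p. 111). Let `N ∈ R^{(n-k)×n}` have rows linearly
independent over `R` and satisfy `N · Q = 0` for `Q ∈ K[X]^{n×k}` (read in `R` through an
injective `ι₀`), and let the rows `I` of `Q` form a non-singular `R_I = Q_I`. Then, with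
`U = N^I`, `V = N^J` (columns `I`, `J`) and `S = Q_J`: `det V ≠ 0` and
`ι₀((S · adj R_I)_{lj}) · det V = ι₀(det R_I) · (−(adj V · U))_{lj}`. [folklore] -/
theorem kernel_matrix_step (ι₀ : K[X] →ₐ[K] R) (hι : Function.Injective ι₀) (hs : IsRowSplit I J)
    (Q : Matrix (Fin n) (Fin k) K[X]) (hR : (Q.submatrix I id).det ≠ 0)
    (N : Matrix (Fin (n - k)) (Fin n) R) (hNind : LinearIndependent R (fun l => N l))
    (hNQ : N * Q.map ι₀ = 0) :
    (N.submatrix id J).det ≠ 0 ∧ ∀ l j,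
      ι₀ ((Q.submatrix J id * (Q.submatrix I id).adjugate) l j) * (N.submatrix id J).det =
        ι₀ (Q.submatrix I id).det * (-((N.submatrix id J).adjugate * N.submatrix id I)) l j := by
  classical
  set U := N.submatrix id I with hU
  set V := N.submatrix id J with hV
  set Rι : Matrix (Fin k) (Fin k) R := (Q.map ι₀).submatrix I id with hRι
  set Sι : Matrix (Fin (n - k)) (Fin k) R := (Q.map ι₀).submatrix J id with hSι
  have hUV : U * Rι + V * Sι = 0 := by rw [hU, hV, hRι, hSι, ← mul_split hs]; exact hNQ
  -- `det R_I ≠ 0` in `R`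
  have hRmap : Rι = (ι₀ : K[X] →+* R).mapMatrix (Q.submatrix I id) := by
    ext i j; rfl
  have hdetRι : Rι.det = ι₀ (Q.submatrix I id).det := by
    rw [hRmap, ← RingHom.map_det]; rfl
  have hdetRι0 : Rι.det ≠ 0 := by
    rw [hdetRι]
    intro h
    exact hR (hι (by rw [h, map_zero]))
  -- `det V ≠ 0`
  have hdetV : V.det ≠ 0 := by
    intro hV0
    obtain ⟨w, hw, hwV⟩ := Matrix.exists_vecMul_eq_zero_iff.mpr hV0
    have hUR : U * Rι = -(V * Sι) := eq_neg_of_add_eq_zero_left hUV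
    have h1 : (w ᵥ* U) ᵥ* Rι = 0 := by
      rw [Matrix.vecMul_vecMul, hUR, Matrix.vecMul_neg, ← Matrix.vecMul_vecMul, hwV,
        Matrix.zero_vecMul, neg_zero]
    have h2 : w ᵥ* U = 0 := Matrix.eq_zero_of_vecMul_eq_zero hdetRι0 h1
    have h3 : w ᵥ* N = 0 := vecMul_eq_zero_of_split hs N w h2 hwV
    apply hw
    funext l
    refine (Fintype.linearIndependent_iff.mp hNind) w ?_ l
    funext i
    have := congr_fun h3 i
    simpa [Matrix.vecMul, dotProduct, Finset.sum_apply, Pi.smul_apply, smul_eq_mul] using this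
  refine ⟨hdetV, fun l j => ?_⟩
  -- `det V • S = -(adj V · U · R_I)` and then `· adj R_I`
  have hadj : V.det • Sι = -(V.adjugate * U * Rι) := by
    have h := congr_arg (fun M => V.adjugate * M) hUV
    simp only [Matrix.mul_add, ← Matrix.mul_assoc, Matrix.adjugate_mul, Matrix.mul_zero,
      Matrix.smul_mul, Matrix.one_mul] at h
    exact eq_neg_of_add_eq_zero_right h
  have hfin : V.det • (Sι * Rι.adjugate) = -(Rι.det • (V.adjugate * U)) := by
    rw [← Matrix.smul_mul, hadj, Matrix.neg_mul, Matrix.mul_assoc, Matrix.mul_adjugate,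
      Matrix.mul_smul, Matrix.mul_one]
  have hmap : Sι * Rι.adjugate = (Q.submatrix J id * (Q.submatrix I id).adjugate).map ι₀ := by
    rw [Matrix.map_mul, hRmap, ← RingHom.map_adjugate]
    rfl
  have hentry := congr_fun (congr_fun hfin l) j
  simp only [Matrix.smul_apply, smul_eq_mul, Matrix.neg_apply, hmap, Matrix.map_apply,
    hdetRι] at hentry
  rw [mul_comm, hentry, Matrix.neg_apply, mul_neg]

end KernelMatrix

/-! ### 2. A common denominator -/

section CommonDenominator

/-- **The common-denominator step.** If every entry of `S · adj R` satisfies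
`(S adj R)_{lj} · q_{lj} = det R · p_{lj}` with `q_{lj} ≠ 0` and `deg p_{lj}, deg q_{lj} ≤ c`,
then `q · S = H · R` for `q = ∏ q_{lj} ≠ 0` and a polynomial matrix `H`, with
`deg q ≤ (n-k)k·c` and `deg H_{lj} ≤ c + (n-k)k·c`. [folklore] -/
theorem common_denominator_step (Rm : Matrix (Fin k) (Fin k) K[X]) (hR : Rm.det ≠ 0)
    (Sm : Matrix (Fin (n - k)) (Fin k) K[X]) (c : ℕ) (pm qm : Fin (n - k) → Fin k → K[X])
    (hq0 : ∀ l j, qm l j ≠ 0) (hdegp : ∀ l j, (pm l j).natDegree ≤ c)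
    (hdegq : ∀ l j, (qm l j).natDegree ≤ c)
    (hpq : ∀ l j, (Sm * Rm.adjugate) l j * qm l j = Rm.det * pm l j) :
    ∃ (q : K[X]) (H : Matrix (Fin (n - k)) (Fin k) K[X]), q ≠ 0 ∧
      q.natDegree ≤ (n - k) * k * c ∧ (∀ l j, (H l j).natDegree ≤ c + (n - k) * k * c) ∧
      q • Sm = H * Rm := by
  classical
  set q : K[X] := ∏ p : Fin (n - k) × Fin k, qm p.1 p.2 with hq
  set O : Fin (n - k) → Fin k → K[X] :=
    fun l j => ∏ p ∈ (Finset.univ : Finset (Fin (n - k) × Fin k)).erase (l, j), qm p.1 p.2 with hO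
  have hqO : ∀ l j, q = qm l j * O l j := by
    intro l j
    rw [hq, hO, Finset.mul_prod_erase _ (fun p : Fin (n - k) × Fin k => qm p.1 p.2)
      (Finset.mem_univ (l, j))]
  have hq0' : q ≠ 0 := Finset.prod_ne_zero_iff.mpr fun p _ => hq0 p.1 p.2
  have hcard : (Finset.univ : Finset (Fin (n - k) × Fin k)).card = (n - k) * k := by
    rw [Finset.card_univ, Fintype.card_prod, Fintype.card_fin, Fintype.card_fin]
  have hdeg_prod : ∀ s : Finset (Fin (n - k) × Fin k),
      (∏ p ∈ s, qm p.1 p.2).natDegree ≤ s.card * c := by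
    intro s
    refine (natDegree_prod_le _ _).trans ?_
    calc ∑ p ∈ s, (qm p.1 p.2).natDegree ≤ ∑ _p ∈ s, c :=
          Finset.sum_le_sum fun p _ => hdegq p.1 p.2
      _ = s.card * c := by rw [Finset.sum_const, smul_eq_mul]
  have hdegq' : q.natDegree ≤ (n - k) * k * c := by
    rw [hq, ← hcard]; exact hdeg_prod _
  have hdegO : ∀ l j, (O l j).natDegree ≤ (n - k) * k * c := by
    intro l j
    refine (hdeg_prod _).trans ?_
    rw [← hcard]
    exact Nat.mul_le_mul_right _ (Finset.card_erase_le)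
  refine ⟨q, Matrix.of fun l j => pm l j * O l j, hq0', hdegq', fun l j => ?_, ?_⟩
  · rw [Matrix.of_apply]
    exact natDegree_mul_le.trans (Nat.add_le_add (hdegp l j) (hdegO l j))
  · -- `det R • (q • S) = det R • (H R)`, then cancel `det R`
    have key : q • (Sm * Rm.adjugate) = Rm.det • Matrix.of fun l j => pm l j * O l j := by
      refine Matrix.ext fun l j => ?_
      simp only [Matrix.smul_apply, smul_eq_mul, Matrix.of_apply]
      rw [hqO l j, mul_comm (qm l j), mul_assoc, mul_comm (qm l j), hpq l j]
      ring
    have key2 : Rm.det • (q • Sm) = Rm.det • ((Matrix.of fun l j => pm l j * O l j) * Rm) := by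
      rw [← Matrix.smul_mul, ← key, Matrix.smul_mul, Matrix.mul_assoc, Matrix.adjugate_mul,
        Matrix.mul_smul, Matrix.mul_one, smul_comm]
    refine Matrix.ext fun l j => ?_
    have := congr_fun (congr_fun key2 l) j
    simp only [Matrix.smul_apply, smul_eq_mul] at this
    exact mul_left_cancel₀ hR this

end CommonDenominator

/-! ### 3. `det R · (qA + BH) = q · L adj R` -/

section VecMul

variable {R : Type*} [CommRing R] [Algebra K R]

/-- Splitting a row vector–matrix product along `I ⊔ J`. [folklore] -/
theorem vecMul_split {β : Type*} [Fintype β] (hs : IsRowSplit I J) (y : Fin n → R)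
    (M : Matrix (Fin n) β R) :
    y ᵥ* M = (y ∘ I) ᵥ* M.submatrix I id + (y ∘ J) ᵥ* M.submatrix J id := by
  funext b
  simp only [Matrix.vecMul, dotProduct, Pi.add_apply, Matrix.submatrix_apply, Function.comp_apply,
    id_eq]
  exact sum_split hs _

/-- **The identity behind Baker's (4)**: if `q · S = H · R` (`R = Q_I`, `S = Q_J`) then for
every row vector `y ∈ Rⁿ` and every `j₀`,
`ι(det R) · (ι(q) y_{I j₀} + ∑ₗ ι(H_{l j₀}) y_{J l}) = ι(q) · (y · Q · adj R)_{j₀}`. [folklore] -/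
theorem vecMul_adjugate_step (ι : K[X] →ₐ[K] R) (hs : IsRowSplit I J)
    (Q : Matrix (Fin n) (Fin k) K[X]) (q : K[X]) (H : Matrix (Fin (n - k)) (Fin k) K[X])
    (hSH : q • Q.submatrix J id = H * Q.submatrix I id) (y : Fin n → R) (j₀ : Fin k) :
    ι (Q.submatrix I id).det * (ι q * y (I j₀) + ∑ l, ι (H l j₀) * y (J l)) =
      ι q * ((y ᵥ* Q.map ι) ᵥ* ((Q.submatrix I id).map ι).adjugate) j₀ := by
  classical
  set Rι : Matrix (Fin k) (Fin k) R := (Q.submatrix I id).map ι with hRι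
  set Sι : Matrix (Fin (n - k)) (Fin k) R := (Q.submatrix J id).map ι with hSι
  have hRmap : Rι = (ι : K[X] →+* R).mapMatrix (Q.submatrix I id) := by ext i j; rfl
  have hdet : Rι.det = ι (Q.submatrix I id).det := by rw [hRmap, ← RingHom.map_det]; rfl
  -- `ι q • S = H R` in `R`
  have hSH' : ι q • Sι = H.map ι * Rι := by
    have := congr_arg (fun M : Matrix (Fin (n - k)) (Fin k) K[X] => M.map ι) hSH
    simp only [Matrix.map_mul] at this
    rw [← this]
    refine Matrix.ext fun l j => ?_
    simp only [Matrix.smul_apply, smul_eq_mul, Matrix.map_apply, map_mul, hSι, Matrix.submatrix_apply,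
      id_eq]
  -- split `y Q = y_I R + y_J S`
  have hsplitQ : y ᵥ* Q.map ι = (y ∘ I) ᵥ* Rι + (y ∘ J) ᵥ* Sι := by
    rw [vecMul_split hs]; rfl
  have hmain : ι q • ((y ᵥ* Q.map ι) ᵥ* Rι.adjugate) =
      Rι.det • (ι q • (y ∘ I) + (y ∘ J) ᵥ* H.map ι) := by
    rw [hsplitQ, Matrix.add_vecMul, Matrix.vecMul_vecMul, Matrix.mul_adjugate, Matrix.vecMul_smul,
      Matrix.vecMul_one, smul_add, Matrix.vecMul_vecMul, ← Matrix.vecMul_smul, ← Matrix.smul_mul,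
      hSH', Matrix.mul_assoc, Matrix.mul_adjugate, Matrix.mul_smul, Matrix.mul_one, Matrix.vecMul_smul,
      smul_comm, smul_add]
  have hentry := congr_fun hmain j₀
  simp only [Pi.smul_apply, smul_eq_mul, Pi.add_apply, Function.comp_apply, hdet] at hentry
  have hRιadj : ((Q.submatrix I id).map ι).adjugate = Rι.adjugate := by rw [hRι]
  rw [hRιadj, hentry]
  congr 1
  simp only [Matrix.vecMul, dotProduct, Function.comp_apply, Matrix.map_apply]
  congr 1
  exact Finset.sum_congr rfl fun l _ => mul_comm _ _

/-- The vector of forms is `y · Q` (up to the order of factors). [folklore] -/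
theorem vecMul_map_eq_form (ι : K[X] →ₐ[K] R) (Q : Matrix (Fin n) (Fin k) K[X]) (y : Fin n → R)
    (j : Fin k) : (y ᵥ* Q.map ι) j = form ι y (fun i => Q i j) := by
  simp only [Matrix.vecMul, dotProduct, Matrix.map_apply, form]
  exact Finset.sum_congr rfl fun i _ => mul_comm _ _

/-- The coefficient vector `φ = q e_{I j₀} + ∑ₗ H_{l j₀} e_{J l}` and its form. [folklore] -/
theorem form_phi (ι : K[X] →ₐ[K] R) (y : Fin n → R) (q : K[X])
    (H : Matrix (Fin (n - k)) (Fin k) K[X]) (j₀ : Fin k) :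
    form ι y (Pi.single (I j₀) q + ∑ l, Pi.single (J l) (H l j₀)) =
      ι q * y (I j₀) + ∑ l, ι (H l j₀) * y (J l) := by
  classical
  rw [form_add, form_sum, form_single]
  congr 1
  exact Finset.sum_congr rfl fun l _ => form_single ι y _ _

/-- `φ` is non-zero at the row `I j₀` (its value there is `q`). [folklore] -/
theorem phi_apply_I (hs : IsRowSplit I J) (q : K[X]) (H : Matrix (Fin (n - k)) (Fin k) K[X])
    (j₀ : Fin k) : (Pi.single (I j₀) q + ∑ l, Pi.single (J l) (H l j₀) : Fin n → K[X]) (I j₀) = q := by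
  classical
  simp only [Pi.add_apply, Finset.sum_apply, Pi.single_eq_same]
  rw [Finset.sum_eq_zero, add_zero]
  intro l _
  exact Pi.single_eq_of_ne (hs.disj j₀ l) _

/-- Degrees of the entries of `φ`. [folklore] -/
theorem natDegree_phi_le (q : K[X]) (H : Matrix (Fin (n - k)) (Fin k) K[X]) (j₀ : Fin k) {c : ℕ}
    (hq : q.natDegree ≤ c) (hH : ∀ l, (H l j₀).natDegree ≤ c) (i : Fin n) :
    ((Pi.single (I j₀) q + ∑ l, Pi.single (J l) (H l j₀) : Fin n → K[X]) i).natDegree ≤ c := by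
  classical
  simp only [Pi.add_apply, Finset.sum_apply]
  refine (natDegree_add_le _ _).trans (max_le ?_ ?_)
  · by_cases h : i = I j₀
    · subst h; rw [Pi.single_eq_same]; exact hq
    · rw [Pi.single_eq_of_ne h]; simp
  · refine (natDegree_sum_le _ _).trans ?_
    rw [Finset.fold_max_le]
    refine ⟨Nat.zero_le _, fun l _ => ?_⟩
    simp only [Function.comp_apply]
    by_cases h : i = J l
    · subst h; rw [Pi.single_eq_same]; exact hH l
    · rw [Pi.single_eq_of_ne h]; simp

end VecMul

end SiegelShidlovskii

end Literature.Barriers.Schanuel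

end
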